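import Mathlib.Analysis.Calculus.BumpFunction.FiniteDimension
import Mathlib.Analysis.Calculus.BumpFunction.Convolution
import Mathlib.MeasureTheory.Function.L2Space
import Mathlib.MeasureTheory.Function.ContinuousMapDense
import Mathlib.Analysis.Distribution.AEEqOfIntegralContDiff
import Literature.Analysis.FluidPDE.EulerSubsolutionCriterion
import Literature.Analysis.FunctionSpaces.TorusPeriodization
import Literature.Analysis.FunctionSpaces.TorusWeakFormBookkeeping
import HarnessLib

/-!
# Székelyhidi's localized convex-integration theorem: the unit-square chart and planar tools

Topic `Analysis/FluidPDE`. Second support file (after `EulerSubsolutionCriterionPieces.lean`)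
for the reduction of the named fact `Torus.Szekelyhidi2011_thm13`
(`EulerSubsolutionCriterion.lean`; Székelyhidi 2011, Thm. 1.3 = De Lellis–Székelyhidi 2010,
Prop. 2, localized, every-time-slice form, on `(0,T) × T²`) to a *planar* statement on
`(0,T) × (0,1)² ⊆ ℝ × ℝ²`, the setting of the flat-coordinate construction
(`ConvexIntegration2D*.lean`). Contents (all proved, no definitions, no named facts):

* **The chart.** `proj : ℝ² → T²` restricted to the open unit square `(0,1)²` with inverse
  `repr : T² → [0,1)²`: `repr` is measure preserving onto Lebesgue measure on `[0,1)²` and a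
  measurable embedding (`integral_comp_repr`, `ae_comp_repr`, and the space–time versions
  `measurePreserving_prodMap_repr`, `ae_comp_prodMap_repr`); `proj '' (0,1)^d` is open, is
  `{y | repr y ∈ (0,1)^d}` (`mem_image_proj_iff`) and has full measure
  (`ae_repr_mem_setOf_mem_Ioo`: its complement lies in finitely many coordinate hyperplanes).
* **Derivatives through the lift.** `∂ₜψ(t, proj x) = D(stLift ψ)(t,x)(1,0)` and
  `D(ψ t)(proj x) w = D(stLift ψ)(t,x)(0,w)` (`timeDeriv_apply_proj`, `fderiv_slice_apply_proj`).
* **Planar tools on `ℝ × ℝ²`** for bounded pairs `(ṽ, ũ)` supported in `(0,T) × V`, `V`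
  bounded: the linear system `∂ₜṽ + div ũ = 0` in `𝒟'(ℝ × ℝ²)` implies the space–time identity
  on `(0,T)` against *every* smooth field (`setIntegral_weakIntegrand_eq_zero_of_test`, smooth
  cut-offs in time and space); weak incompressibility against compactly supported smooth
  functions implies it against all smooth functions (`integral_inner_gradient_eq_zero_of_test`);
  smooth compactly supported fields are dense in `L^p(ℝ²)` (`exists_smooth_eLpNorm_sub_le`,
  mollification of Mathlib's continuous compactly supported approximants), whence weak
  continuity in time against test fields upgrades to weak continuity against all of `L²`
  under a uniform `L²` bound (`continuous_integral_inner_of_test`).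

## References

* L. Székelyhidi Jr., C. R. Math. Acad. Sci. Paris 349 (2011) 1063–1066, Thm. 1.3 and its proof
  (`Szekelyhidi2011`).
* C. De Lellis, L. Székelyhidi Jr., Arch. Ration. Mech. Anal. 195 (2010) 225–260, Prop. 2, §4
  (`DeLellisSzekelyhidi2010`).
* L. Grafakos, *Classical Fourier Analysis*, 3rd ed., §3.1.1 (the torus as `[0,1)ⁿ`)
  (`Grafakos2014`).
-/

open MeasureTheory Set Filter Function Metric
open scoped InnerProductSpace ContDiff Topology ENNReal
open Literature.Analysis.FunctionSpaces
open Literature.Analysis.FunctionSpaces.Torus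

noncomputable section

namespace Literature.Analysis.FluidPDE

namespace Torus

variable {d : Type*} [Fintype d]

/-! ### The open unit square chart of the torus -/

section Chart

omit [Fintype d] in
/-- `repr` has range the half-open unit cube. [folklore] -/
theorem range_repr : range (repr : UnitAddTorus d → EuclideanSpace ℝ d) = unitCube d := by
  refine Subset.antisymm ?_ fun v hv => ⟨proj v, repr_proj_of_mem_unitCube_holds hv⟩
  rintro _ ⟨z, rfl⟩
  exact repr_mem_unitCube z

/-- Integration over `T^d` through the fundamental domain: `∫_{T^d} g (repr y) dy = ∫_{[0,1)^d} g`
(`repr` is a measurable embedding with measurable left inverse `proj`, and measure preserving onto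
Lebesgue measure on the unit cube; Grafakos, §3.1.1). [folklore] -/
theorem integral_comp_repr {F : Type*} [NormedAddCommGroup F] [NormedSpace ℝ F]
    (g : EuclideanSpace ℝ d → F) : ∫ y, g (repr y) = ∫ x in unitCube d, g x := by
  have hemb : MeasurableEmbedding (repr : UnitAddTorus d → EuclideanSpace ℝ d) :=
    MeasurableEmbedding.of_measurable_inverse measurable_repr
      (by rw [range_repr]; exact measurableSet_unitCube) measurable_proj proj_repr
  exact (measurePreserving_repr (d := d)).integral_comp hemb g

/-- Almost-everywhere statements transfer from `ℝ^d` to `T^d` along `repr`. [folklore] -/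
theorem ae_comp_repr {P : EuclideanSpace ℝ d → Prop} (h : ∀ᵐ x ∂volume, P x) :
    ∀ᵐ y : UnitAddTorus d ∂volume, P (repr y) :=
  (quasiMeasurePreserving_repr (d := d)).ae h

/-- `(t, y) ↦ (t, repr y)` is measure preserving from `ℝ × T^d` to `ℝ × [0,1)^d`. [folklore] -/
theorem measurePreserving_prodMap_repr :
    MeasurePreserving (Prod.map id repr : ℝ × UnitAddTorus d → ℝ × EuclideanSpace ℝ d) volume
      (volume.restrict (univ ×ˢ unitCube d)) := by
  have h := (MeasurePreserving.id (volume : Measure ℝ)).prod (measurePreserving_repr (d := d))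
  have e : (volume : Measure ℝ).prod ((volume : Measure (EuclideanSpace ℝ d)).restrict (unitCube d)) =
      ((volume : Measure ℝ).prod (volume : Measure (EuclideanSpace ℝ d))).restrict
        (univ ×ˢ unitCube d) := by
    rw [← Measure.prod_restrict, Measure.restrict_univ]
  rw [Measure.volume_eq_prod, Measure.volume_eq_prod, ← e]
  exact h

/-- `(t, y) ↦ (t, repr y)` is quasi measure preserving into `ℝ × ℝ^d`. [folklore] -/
theorem quasiMeasurePreserving_prodMap_repr :
    Measure.QuasiMeasurePreserving (Prod.map id repr : ℝ × UnitAddTorus d → ℝ × EuclideanSpace ℝ d)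
      volume volume :=
  ⟨measurable_id.prodMap measurable_repr, by
    rw [(measurePreserving_prodMap_repr (d := d)).map_eq]
    exact Measure.restrict_le_self.absolutelyContinuous⟩

/-- Space–time almost-everywhere statements transfer from `ℝ × ℝ^d` to `ℝ × T^d`. [folklore] -/
theorem ae_comp_prodMap_repr {P : ℝ × EuclideanSpace ℝ d → Prop} (h : ∀ᵐ p ∂volume, P p) :
    ∀ᵐ p : ℝ × UnitAddTorus d ∂volume, P (p.1, repr p.2) :=
  (quasiMeasurePreserving_prodMap_repr (d := d)).ae h

omit [Fintype d] in
/-- `proj` maps open sets to open sets. [folklore] -/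
theorem isOpen_image_proj {V : Set (EuclideanSpace ℝ d)} (hV : IsOpen V) :
    IsOpen (proj '' V : Set (UnitAddTorus d)) :=
  isOpenQuotientMap_proj.isOpenMap V hV

omit [Fintype d] in
/-- A point of the torus lies over a subset `V` of the fundamental domain iff its representative
lies in `V`. [folklore] -/
theorem mem_image_proj_iff {V : Set (EuclideanSpace ℝ d)} (hV : V ⊆ unitCube d)
    (y : UnitAddTorus d) : y ∈ proj '' V ↔ repr y ∈ V := by
  constructor
  · rintro ⟨x, hx, rfl⟩
    rwa [repr_proj_of_mem_unitCube_holds (hV hx)]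
  · intro h
    exact ⟨repr y, h, proj_repr y⟩

omit [Fintype d] in
/-- The open unit square lies in the half-open unit cube. [folklore] -/
theorem setOf_mem_Ioo_subset_unitCube :
    {x : EuclideanSpace ℝ d | ∀ i, x i ∈ Ioo (0 : ℝ) 1} ⊆ unitCube d :=
  fun _ hx i => Ioo_subset_Ico_self (hx i)

/-- The open unit cube `(0,1)^d` is open. [folklore] -/
theorem isOpen_setOf_mem_Ioo :
    IsOpen {x : EuclideanSpace ℝ d | ∀ i, x i ∈ Ioo (0 : ℝ) 1} := by
  have : {x : EuclideanSpace ℝ d | ∀ i, x i ∈ Ioo (0 : ℝ) 1} =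
      ⋂ i, (fun x : EuclideanSpace ℝ d => x i) ⁻¹' Ioo 0 1 := by
    ext x; simp
  rw [this]
  exact isOpen_iInter_of_finite fun i => isOpen_Ioo.preimage (by fun_prop)

omit [Fintype d] in
/-- A representative not in the open cube has a vanishing coordinate. [folklore] -/
theorem exists_apply_eq_zero_of_repr_not_mem {y : UnitAddTorus d}
    (hy : repr y ∉ {x : EuclideanSpace ℝ d | ∀ i, x i ∈ Ioo (0 : ℝ) 1}) : ∃ i, y i = 0 := by
  simp only [mem_setOf_eq, not_forall] at hy
  obtain ⟨i, hi⟩ := hy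
  refine ⟨i, ?_⟩
  have hIco := repr_apply_mem_Ico y i
  have h0 : repr y i = 0 := by
    rcases hIco with ⟨h1, h2⟩
    by_contra hne
    exact hi ⟨lt_of_le_of_ne h1 (Ne.symm hne), h2⟩
  have h := congrArg (fun x : EuclideanSpace ℝ d => proj x i) (show repr y = repr y from rfl)
  have hproj : proj (repr y) i = y i := by rw [proj_repr]
  rw [← hproj, proj_apply, h0]
  simp

/-- A coordinate hyperplane `{y | y i = b}` of the torus is null (points of `T¹` are null).
[folklore] -/
theorem volume_setOf_apply_eq (i : d) (b : UnitAddCircle) :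
    volume {y : UnitAddTorus d | y i = b} = 0 := by
  have hpt : ∀ c : UnitAddCircle, volume ({c} : Set UnitAddCircle) = 0 := fun c => by
    rw [← Metric.closedBall_zero, AddCircle.volume_closedBall]
    simp
  haveI : NullSingletonClass (volume : Measure UnitAddCircle) := ⟨hpt⟩
  have h : (volume : Measure (UnitAddTorus d)) =
      Measure.pi fun _ : d => (volume : Measure UnitAddCircle) := rfl
  rw [h]
  exact Measure.pi_hyperplane (fun _ : d => (volume : Measure UnitAddCircle)) i b

/-- The torus points over the open unit cube form a set of full measure. [folklore] -/
theorem ae_repr_mem_setOf_mem_Ioo :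
    ∀ᵐ y : UnitAddTorus d ∂volume, repr y ∈ {x : EuclideanSpace ℝ d | ∀ i, x i ∈ Ioo (0 : ℝ) 1} := by
  have hU : volume (⋃ i : d, {y : UnitAddTorus d | y i = 0}) = 0 :=
    measure_iUnion_null fun i => volume_setOf_apply_eq i 0
  rw [ae_iff]
  refine measure_mono_null (fun y hy => ?_) hU
  obtain ⟨i, hi⟩ := exists_apply_eq_zero_of_repr_not_mem hy
  exact mem_iUnion.2 ⟨i, hi⟩

end Chart

/-! ### Derivatives through the space–time lift -/

section LiftDerivatives

variable {F : Type*} [NormedAddCommGroup F] [NormedSpace ℝ F]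

/-- The torus time derivative is the time-directional Fréchet derivative of the space–time lift:
`∂ₜψ (t, proj x) = D(stLift ψ)(t, x) (1, 0)`. [folklore] -/
theorem timeDeriv_apply_proj {ψ : ℝ → UnitAddTorus d → F} (hψ : ContDiff ℝ ∞ (stLift ψ))
    (t : ℝ) (x : EuclideanSpace ℝ d) :
    timeDeriv ψ t (proj x) = fderiv ℝ (stLift ψ) (t, x) ((1 : ℝ), (0 : EuclideanSpace ℝ d)) := by
  have h0 : timeDeriv ψ t (proj x) = stLift (timeDeriv ψ) (t, x) := rfl
  rw [h0, stLift_timeDeriv]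
  show fderiv ℝ (fun τ : ℝ => stLift ψ (τ, x)) t 1 = _
  have hd : HasFDerivAt (stLift ψ) (fderiv ℝ (stLift ψ) (t, x)) (t, x) :=
    ((hψ.differentiable (by simp)) (t, x)).hasFDerivAt
  have hc : HasFDerivAt (fun τ : ℝ => ((τ, x) : ℝ × EuclideanSpace ℝ d))
      (ContinuousLinearMap.inl ℝ ℝ (EuclideanSpace ℝ d)) t := hasFDerivAt_prodMk_left t x
  have h := hd.comp t hc
  rw [show (fun τ : ℝ => stLift ψ (τ, x)) = stLift ψ ∘ fun τ : ℝ => ((τ, x) : ℝ × EuclideanSpace ℝ d)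
    from rfl, h.fderiv]
  rfl

/-- Spatial torus derivatives of the slices through the space–time lift:
`D(ψ t)(proj x) w = D(stLift ψ)(t, x) (0, w)`. [folklore] -/
theorem fderiv_slice_apply_proj {ψ : ℝ → UnitAddTorus d → F} (hψ : ContDiff ℝ ∞ (stLift ψ))
    (t : ℝ) (x w : EuclideanSpace ℝ d) :
    FunctionSpaces.Torus.fderiv (ψ t) (proj x) w = fderiv ℝ (stLift ψ) (t, x) ((0 : ℝ), w) := by
  have hst : IsSmoothSpaceTimeOn univ ψ := hψ.contDiffOn
  rw [hst.fderiv_slice_apply (mem_univ t), univ_prod_univ, fderivWithin_univ]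

end LiftDerivatives

/-! ### Planar fields supported in a bounded set: removing the support condition on tests -/

section PlanarCutoff

/-- **From every-slice bounds to a space–time bound** on `ℝ × Y`: if `w` is jointly a.e.
strongly measurable and `‖w(t, ·)‖ ≤ C` a.e. for every `t`, then `‖w‖ ≤ C` a.e. (Fubini for
the super-level set of a measurable modification). [folklore] -/
theorem ae_norm_le_of_forall_ae_slice {Y : Type*} [MeasureSpace Y] [SFinite (volume : Measure Y)]
    {G : Type*} [NormedAddCommGroup G] {w : ℝ × Y → G} {C : ℝ}
    (hwm : AEStronglyMeasurable w (volume : Measure (ℝ × Y)))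
    (hb : ∀ t, ∀ᵐ x : Y ∂volume, ‖w (t, x)‖ ≤ C) :
    ∀ᵐ p : ℝ × Y ∂volume, ‖w p‖ ≤ C := by
  set g : ℝ × Y → G := hwm.mk w with hg_def
  have hg : StronglyMeasurable g := hwm.stronglyMeasurable_mk
  have hae : w =ᵐ[volume] g := hwm.ae_eq_mk
  have hae' : ∀ᵐ t : ℝ, ∀ᵐ x : Y, w (t, x) = g (t, x) := by
    rw [Measure.volume_eq_prod] at hae
    exact Measure.ae_ae_of_ae_prod hae
  have hN : MeasurableSet {p : ℝ × Y | C < ‖g p‖} :=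
    measurableSet_lt measurable_const hg.norm.measurable
  have hnull : volume {p : ℝ × Y | C < ‖g p‖} = 0 := by
    rw [Measure.volume_eq_prod, Measure.prod_apply hN]
    have h0 : ∀ᵐ t : ℝ, (volume : Measure Y) (Prod.mk t ⁻¹' {p : ℝ × Y | C < ‖g p‖}) = 0 := by
      filter_upwards [hae'] with t ht
      refine measure_eq_zero_iff_ae_notMem.2 ?_
      filter_upwards [ht, hb t] with x hx hxb
      simp only [mem_preimage, mem_setOf_eq, not_lt]
      rw [← hx]
      exact hxb
    rw [lintegral_congr_ae h0, lintegral_zero]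
  have h1 : ∀ᵐ p : ℝ × Y, ‖g p‖ ≤ C := by
    rw [ae_iff]
    simpa [not_le] using hnull
  filter_upwards [h1, hae] with p hp hpe
  rw [hpe]
  exact hp


/-- A smooth cut-off pair `η(t) χ(x)` turns a smooth field on `ℝ × ℝ²` into a compactly supported
one that agrees with it near `[0,T] × B(0,R)`. [folklore] -/
theorem exists_test_eq_nhds {Φ : ℝ × (EuclideanSpace ℝ (Fin 2)) → (EuclideanSpace ℝ (Fin 2))} (hΦ : ContDiff ℝ ∞ Φ) (T R : ℝ) (hR : 0 < R) :
    ∃ Φ' : ℝ × (EuclideanSpace ℝ (Fin 2)) → (EuclideanSpace ℝ (Fin 2)), ContDiff ℝ ∞ Φ' ∧ HasCompactSupport Φ' ∧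
      ∀ p ∈ Ioo (-1 : ℝ) (|T| + 1) ×ˢ ball (0 : (EuclideanSpace ℝ (Fin 2))) R, Φ' =ᶠ[𝓝 p] Φ := by
  -- time cut-off: `= 1` on `[-1, |T|+1]`, spatial cut-off: `= 1` on `B̄(0, R)`
  let η : ContDiffBump (|T| / 2 : ℝ) := ⟨|T| / 2 + 1, |T| / 2 + 2, by positivity, by linarith⟩
  let χ : ContDiffBump (0 : (EuclideanSpace ℝ (Fin 2))) := ⟨R, R + 1, hR, by linarith⟩
  refine ⟨fun p => (η p.1 * χ p.2) • Φ p, ?_, ?_, ?_⟩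
  · exact ((η.contDiff.comp contDiff_fst).mul (χ.contDiff.comp contDiff_snd)).smul hΦ
  · refine HasCompactSupport.intro
      ((isCompact_closedBall (|T| / 2 : ℝ) (|T| / 2 + 2)).prod (isCompact_closedBall (0 : (EuclideanSpace ℝ (Fin 2))) (R + 1)))
      fun p hp => ?_
    rw [mem_prod, not_and_or] at hp
    rcases hp with h | h
    · rw [mem_closedBall, not_le] at h
      rw [η.zero_of_le_dist h.le, zero_mul, zero_smul]
    · rw [mem_closedBall, not_le] at h
      rw [χ.zero_of_le_dist h.le, mul_zero, zero_smul]
  · rintro p ⟨hp1, hp2⟩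
    have hO : IsOpen (Ioo (-1 : ℝ) (|T| + 1) ×ˢ ball (0 : (EuclideanSpace ℝ (Fin 2))) R) := isOpen_Ioo.prod isOpen_ball
    filter_upwards [hO.mem_nhds ⟨hp1, hp2⟩] with q hq
    have h1 : η q.1 = 1 := by
      refine η.one_of_mem_closedBall ?_
      rw [mem_closedBall, Real.dist_eq]
      have := hq.1
      rw [mem_Ioo] at this
      change |q.1 - |T| / 2| ≤ |T| / 2 + 1
      exact abs_le.2 ⟨by linarith, by linarith⟩
    have h2 : χ q.2 = 1 := χ.one_of_mem_closedBall (ball_subset_closedBall hq.2)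
    rw [h1, h2, one_mul, one_smul]

/-- A smooth spatial cut-off turns a smooth function on `ℝ²` into a compactly supported one that
agrees with it near `B(0,R)`. [folklore] -/
theorem exists_test_eq_nhds_space {Θ : (EuclideanSpace ℝ (Fin 2)) → ℝ} (hΘ : ContDiff ℝ ∞ Θ) (R : ℝ) (hR : 0 < R) :
    ∃ Θ' : (EuclideanSpace ℝ (Fin 2)) → ℝ, ContDiff ℝ ∞ Θ' ∧ HasCompactSupport Θ' ∧ ∀ x ∈ ball (0 : (EuclideanSpace ℝ (Fin 2))) R, Θ' =ᶠ[𝓝 x] Θ := by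
  let χ : ContDiffBump (0 : (EuclideanSpace ℝ (Fin 2))) := ⟨R, R + 1, hR, by linarith⟩
  refine ⟨fun x => χ x * Θ x, χ.contDiff.mul hΘ, χ.hasCompactSupport.mul_right, fun x hx => ?_⟩
  filter_upwards [isOpen_ball.mem_nhds hx] with y hy
  rw [χ.one_of_mem_closedBall (ball_subset_closedBall hy), one_mul]

/-- Derivatives of a smooth compactly supported field are bounded. [folklore] -/
theorem exists_bound_fderiv_of_hasCompactSupport {Φ : ℝ × (EuclideanSpace ℝ (Fin 2)) → (EuclideanSpace ℝ (Fin 2))} (hΦ : ContDiff ℝ ∞ Φ)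
    (hΦc : HasCompactSupport Φ) : ∃ M : ℝ, ∀ p, ‖fderiv ℝ Φ p‖ ≤ M :=
  (hΦc.fderiv (𝕜 := ℝ)).exists_bound_of_continuous (hΦ.continuous_fderiv (by simp))

variable {T : ℝ} {V : Set (EuclideanSpace ℝ (Fin 2))} {w : ℝ × (EuclideanSpace ℝ (Fin 2)) → (EuclideanSpace ℝ (Fin 2))} {z : ℝ × (EuclideanSpace ℝ (Fin 2)) → Matrix (Fin 2) (Fin 2) ℝ} {C : ℝ}

/-- The weak-form integrand of a pair `(ṽ, ũ)` against a field `Φ`. [folklore] -/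
theorem abs_planarWeakIntegrand_le {p : ℝ × (EuclideanSpace ℝ (Fin 2))} {Φ : ℝ × (EuclideanSpace ℝ (Fin 2)) → (EuclideanSpace ℝ (Fin 2))} {M : ℝ} (hM : ‖fderiv ℝ Φ p‖ ≤ M)
    (hw : ‖w p‖ ≤ C) (hz : ∀ i j, |z p i j| ≤ C) :
    |⟪w p, fderiv ℝ Φ p (1, 0)⟫_ℝ + ∑ i, ∑ j, z p i j * fderiv ℝ Φ p (0, EuclideanSpace.single j 1) i|
      ≤ C * M + 4 * (C * M) := by
  have hC : 0 ≤ C := (norm_nonneg _).trans hw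
  have hM0 : 0 ≤ M := (norm_nonneg _).trans hM
  have h1 : |⟪w p, fderiv ℝ Φ p (1, 0)⟫_ℝ| ≤ C * M := by
    rw [← Real.norm_eq_abs]
    refine (norm_inner_le_norm _ _).trans (mul_le_mul hw ?_ (norm_nonneg _) hC)
    refine (ContinuousLinearMap.le_opNorm _ _).trans ?_
    have : ‖((1 : ℝ), (0 : (EuclideanSpace ℝ (Fin 2))))‖ ≤ 1 := by simp [Prod.norm_def]
    nlinarith [norm_nonneg (fderiv ℝ Φ p)]
  have hterm : ∀ i j, |z p i j * fderiv ℝ Φ p (0, EuclideanSpace.single j 1) i| ≤ C * M := by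
    intro i j
    rw [abs_mul]
    refine mul_le_mul (hz i j) ?_ (abs_nonneg _) hC
    rw [← Real.norm_eq_abs]
    refine (PiLp.norm_apply_le _ _).trans ((ContinuousLinearMap.le_opNorm _ _).trans ?_)
    have : ‖((0 : ℝ), EuclideanSpace.single j (1 : ℝ))‖ ≤ 1 := by simp [Prod.norm_def]
    nlinarith [norm_nonneg (fderiv ℝ Φ p)]
  calc |⟪w p, fderiv ℝ Φ p (1, 0)⟫_ℝ + ∑ i, ∑ j, z p i j * fderiv ℝ Φ p (0, EuclideanSpace.single j 1) i|
      ≤ |⟪w p, fderiv ℝ Φ p (1, 0)⟫_ℝ| + |∑ i, ∑ j, z p i j * fderiv ℝ Φ p (0, EuclideanSpace.single j 1) i| :=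
        abs_add_le _ _
    _ ≤ C * M + ∑ i, ∑ j, |z p i j * fderiv ℝ Φ p (0, EuclideanSpace.single j 1) i| := by
        refine add_le_add h1 ((Finset.abs_sum_le_sum_abs _ _).trans (Finset.sum_le_sum fun i _ => ?_))
        exact Finset.abs_sum_le_sum_abs _ _
    _ ≤ C * M + ∑ _i : Fin 2, ∑ _j : Fin 2, C * M := by
        gcongr with i _ j _
        exact hterm i j
    _ = C * M + 4 * (C * M) := by
        simp only [Finset.sum_const, Finset.card_univ, Fintype.card_fin]; ring

/-- **The linear system against all smooth fields.** If `(ṽ, ũ)` are bounded, `ṽ` vanishes off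
`(0,T) × V` on every time slice and `ũ` a.e., `V` bounded, and `∂ₜ ṽ + div ũ = 0` holds in
`𝒟'(ℝ × ℝ²)` (smooth compactly supported tests), then the space–time identity on `(0,T)` holds
for every smooth field `Φ` on `ℝ × ℝ²`, with no support condition (cut `Φ` off outside a
neighbourhood of `[0,T] × V̄`; the pairing does not see the modification). [folklore] -/
theorem setIntegral_weakIntegrand_eq_zero_of_test (hV : Bornology.IsBounded V)
    (hwm : AEStronglyMeasurable w volume)
    (hzm : ∀ i j, AEStronglyMeasurable (fun p : ℝ × (EuclideanSpace ℝ (Fin 2)) => z p i j) volume)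
    (hwC : ∀ t, ∀ᵐ x ∂volume, ‖w (t, x)‖ ≤ C) (hzC : ∀ i j, ∀ᵐ p ∂volume, |z p i j| ≤ C)
    (hw0 : ∀ t, ∀ᵐ x ∂volume, (t, x) ∉ Ioo 0 T ×ˢ V → w (t, x) = 0)
    (hz0 : ∀ᵐ p ∂volume, p ∉ Ioo 0 T ×ˢ V → z p = 0)
    (hpde : ∀ φ : ℝ × (EuclideanSpace ℝ (Fin 2)) → (EuclideanSpace ℝ (Fin 2)), ContDiff ℝ ∞ φ → HasCompactSupport φ →
      ∫ p, (⟪w p, fderiv ℝ φ p (1, 0)⟫_ℝ +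
        ∑ i, ∑ j, z p i j * fderiv ℝ φ p (0, EuclideanSpace.single j 1) i) = 0)
    {Φ : ℝ × (EuclideanSpace ℝ (Fin 2)) → (EuclideanSpace ℝ (Fin 2))} (hΦ : ContDiff ℝ ∞ Φ) :
    ∫ t in Ioo 0 T, ∫ x, (⟪w (t, x), fderiv ℝ Φ (t, x) (1, 0)⟫_ℝ +
      ∑ i, ∑ j, z (t, x) i j * fderiv ℝ Φ (t, x) (0, EuclideanSpace.single j 1) i) = 0 := by
  -- the cut-off field
  obtain ⟨R, hR0, hVR⟩ : ∃ R, 0 < R ∧ V ⊆ ball (0 : (EuclideanSpace ℝ (Fin 2))) R := by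
    obtain ⟨R, hR⟩ := hV.subset_ball_lt 0 0
    exact ⟨R, hR.1, hR.2⟩
  obtain ⟨Φ', hΦ', hΦ'c, hagree⟩ := exists_test_eq_nhds hΦ T R hR0
  obtain ⟨M, hM⟩ := exists_bound_fderiv_of_hasCompactSupport hΦ' hΦ'c
  -- notation for the two integrands
  set F : ℝ × (EuclideanSpace ℝ (Fin 2)) → ℝ := fun p => ⟪w p, fderiv ℝ Φ p (1, 0)⟫_ℝ +
    ∑ i, ∑ j, z p i j * fderiv ℝ Φ p (0, EuclideanSpace.single j 1) i with hF_def
  set F' : ℝ × (EuclideanSpace ℝ (Fin 2)) → ℝ := fun p => ⟪w p, fderiv ℝ Φ' p (1, 0)⟫_ℝ +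
    ∑ i, ∑ j, z p i j * fderiv ℝ Φ' p (0, EuclideanSpace.single j 1) i with hF'_def
  have hId : ∫ p, F' p = 0 := hpde Φ' hΦ' hΦ'c
  -- `F'` is integrable: bounded, and supported in the compact `tsupport Φ'`
  have hwC' : ∀ᵐ p : ℝ × (EuclideanSpace ℝ (Fin 2)) ∂volume, ‖w p‖ ≤ C :=
    ae_norm_le_of_forall_ae_slice hwm hwC
  have hDc : ∀ v : ℝ × (EuclideanSpace ℝ (Fin 2)), Continuous fun p => fderiv ℝ Φ' p v := fun v =>
    (hΦ'.continuous_fderiv (by simp)).clm_apply continuous_const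
  have hF'm : AEStronglyMeasurable F' volume := by
    refine (hwm.inner (hDc (1, 0)).aestronglyMeasurable).add ?_
    refine Finset.aestronglyMeasurable_fun_sum _ fun i _ =>
      Finset.aestronglyMeasurable_fun_sum _ fun j _ => (hzm i j).mul ?_
    exact ((EuclideanSpace.proj i).continuous.comp (hDc _)).aestronglyMeasurable
  have hF'b : ∀ᵐ p ∂volume, ‖F' p‖ ≤ C * M + 4 * (C * M) := by
    filter_upwards [hwC', hzC 0 0, hzC 0 1, hzC 1 0, hzC 1 1] with p hwp h00 h01 h10 h11
    have hzall : ∀ i j, |z p i j| ≤ C := by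
      intro i j
      fin_cases i <;> fin_cases j
      · exact h00
      · exact h01
      · exact h10
      · exact h11
    rw [Real.norm_eq_abs]
    exact abs_planarWeakIntegrand_le (hM p) hwp hzall
  have hF'supp : support F' ⊆ tsupport Φ' := by
    intro p hp
    by_contra h
    have h0 : fderiv ℝ Φ' p = 0 := by
      rw [notMem_tsupport_iff_eventuallyEq] at h
      rw [h.fderiv_eq]
      simp
    apply hp
    simp [hF'_def, h0]
  have hF'i : Integrable F' volume := by
    rw [← integrableOn_iff_integrable_of_support_subset hF'supp]
    exact Measure.integrableOn_of_bounded (M := C * M + 4 * (C * M))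
      hΦ'c.isCompact.measure_lt_top.ne hF'm (ae_restrict_of_ae hF'b)
  -- slices: `z(t, ·) = 0` a.e. off `(0,T) × V` for a.e. `t`
  have hz0' : ∀ᵐ t : ℝ, ∀ᵐ x : (EuclideanSpace ℝ (Fin 2)), (t, x) ∉ Ioo 0 T ×ˢ V → z (t, x) = 0 := by
    rw [Measure.volume_eq_prod] at hz0
    exact Measure.ae_ae_of_ae_prod hz0
  -- Step 1: Fubini
  have h1 : ∫ p, F' p = ∫ t, ∫ x, F' (t, x) := by
    rw [Measure.volume_eq_prod] at hF'i ⊢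
    exact integral_prod F' hF'i
  -- Step 2: the time integral lives on `(0,T)`
  have h2 : ∫ t, ∫ x, F' (t, x) = ∫ t in Ioo 0 T, ∫ x, F' (t, x) := by
    refine (setIntegral_eq_integral_of_ae_compl_eq_zero ?_).symm
    filter_upwards [hz0'] with t hzt ht
    have hae : (fun x => F' (t, x)) =ᵐ[volume] 0 := by
      filter_upwards [hw0 t, hzt] with x hwx hzx
      have hnot : (t, x) ∉ Ioo 0 T ×ˢ V := fun h => ht h.1
      simp [hF'_def, hwx hnot, hzx hnot]
    rw [integral_congr_ae hae, Pi.zero_def, integral_zero]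
  -- Step 3: on `(0,T)` the integrands of `Φ'` and `Φ` agree a.e.
  have h3 : ∫ t in Ioo 0 T, ∫ x, F' (t, x) = ∫ t in Ioo 0 T, ∫ x, F (t, x) := by
    refine setIntegral_congr_ae measurableSet_Ioo ?_
    filter_upwards [hz0'] with t hzt ht
    refine integral_congr_ae ?_
    filter_upwards [hw0 t, hzt] with x hwx hzx
    by_cases hx : x ∈ V
    · have hp : (t, x) ∈ Ioo (-1 : ℝ) (|T| + 1) ×ˢ ball (0 : (EuclideanSpace ℝ (Fin 2))) R :=
        ⟨⟨by linarith [ht.1], by linarith [ht.2, le_abs_self T]⟩, hVR hx⟩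
      have hD : fderiv ℝ Φ' (t, x) = fderiv ℝ Φ (t, x) := (hagree _ hp).fderiv_eq
      simp [hF_def, hF'_def, hD]
    · have hnot : (t, x) ∉ Ioo 0 T ×ˢ V := fun h => hx h.2
      simp [hF_def, hF'_def, hwx hnot, hzx hnot]
  rw [← h3, ← h2, ← h1, hId]

/-- **Weak incompressibility against all smooth functions.** If `ṽ(t)` vanishes a.e. off the
bounded set `V` and `∫ ṽ(t)·∇θ = 0` for compactly supported smooth `θ`, then the same holds
for every smooth `θ`. [folklore] -/
theorem integral_inner_gradient_eq_zero_of_test (hV : Bornology.IsBounded V) {wt : (EuclideanSpace ℝ (Fin 2)) → (EuclideanSpace ℝ (Fin 2))}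
    (hw0 : ∀ᵐ x ∂volume, x ∉ V → wt x = 0)
    (hdiv : ∀ θ : (EuclideanSpace ℝ (Fin 2)) → ℝ, ContDiff ℝ ∞ θ → HasCompactSupport θ →
      ∫ x, ⟪wt x, _root_.gradient θ x⟫_ℝ = 0)
    {Θ : (EuclideanSpace ℝ (Fin 2)) → ℝ} (hΘ : ContDiff ℝ ∞ Θ) : ∫ x, ⟪wt x, _root_.gradient Θ x⟫_ℝ = 0 := by
  obtain ⟨R, hR0, hVR⟩ : ∃ R, 0 < R ∧ V ⊆ ball (0 : (EuclideanSpace ℝ (Fin 2))) R := by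
    obtain ⟨R, hR⟩ := hV.subset_ball_lt 0 0
    exact ⟨R, hR.1, hR.2⟩
  obtain ⟨Θ', hΘ', hΘ'c, hagree⟩ := exists_test_eq_nhds_space hΘ R hR0
  rw [← hdiv Θ' hΘ' hΘ'c]
  refine integral_congr_ae ?_
  filter_upwards [hw0] with x hx
  by_cases hxV : x ∈ V
  · have h : _root_.gradient Θ' x = _root_.gradient Θ x := by
      unfold _root_.gradient
      rw [(hagree x (hVR hxV)).fderiv_eq]
    rw [h]
  · rw [hx hxV, inner_zero_left, inner_zero_left]

/-- The Fréchet derivative of a real function on `ℝ²` applied to a vector, in coordinates. [folklore] -/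
theorem fderiv_apply_eq_sum_mul_fderiv_single {θ : (EuclideanSpace ℝ (Fin 2)) → ℝ}
    (x a : (EuclideanSpace ℝ (Fin 2))) :
    fderiv ℝ θ x a = ∑ j, a j * fderiv ℝ θ x (EuclideanSpace.single j 1) := by
  have h : ∑ j, a j • EuclideanSpace.single j (1 : ℝ) = a := by
    simpa only [EuclideanSpace.basisFun_apply, EuclideanSpace.basisFun_repr] using
      (EuclideanSpace.basisFun (Fin 2) ℝ).sum_repr a
  conv_lhs => rw [← h]
  rw [map_sum]
  refine Finset.sum_congr rfl fun j _ => ?_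
  rw [map_smul, smul_eq_mul]

/-- The pairing with a gradient in coordinates: `⟪a, ∇θ(x)⟫ = ∑ⱼ aⱼ ∂ⱼθ(x)`. [folklore] -/
theorem inner_gradient_eq_sum_mul_fderiv_single {θ : (EuclideanSpace ℝ (Fin 2)) → ℝ}
    (x a : (EuclideanSpace ℝ (Fin 2))) :
    ⟪a, _root_.gradient θ x⟫_ℝ = ∑ j, a j * fderiv ℝ θ x (EuclideanSpace.single j 1) := by
  rw [_root_.gradient, real_inner_comm, InnerProductSpace.toDual_symm_apply]
  exact fderiv_apply_eq_sum_mul_fderiv_single x a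

/-- **Weak incompressibility on every time slice from the space–time distributional form.**
If `ṽ` is bounded, `div ṽ = 0` in `𝒟'(ℝ × ℝ²)` (scalar smooth compactly supported tests,
`∫∫ ∑ⱼ ṽⱼ ∂ⱼφ = 0`) and `t ↦ ∫ ṽ(t,x)·g(x) dx` is continuous for smooth compactly supported
`g`, then `∫ ṽ(t,·)·∇θ = 0` for *every* `t` and every smooth compactly supported `θ` (test with
`φ(s,x) = η(s)θ(x)`: the continuous function `s ↦ ∫ ṽ(s,·)·∇θ` integrates to zero against every
`η ∈ C_c^∞(ℝ)`, hence vanishes identically). [folklore] -/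
theorem integral_inner_gradient_eq_zero_of_spaceTime
    {w : ℝ × (EuclideanSpace ℝ (Fin 2)) → (EuclideanSpace ℝ (Fin 2))} {C : ℝ}
    (hwm : AEStronglyMeasurable w volume)
    (hwC : ∀ t, ∀ᵐ x : (EuclideanSpace ℝ (Fin 2)) ∂volume, ‖w (t, x)‖ ≤ C)
    (hcont : ∀ g : (EuclideanSpace ℝ (Fin 2)) → (EuclideanSpace ℝ (Fin 2)), ContDiff ℝ ∞ g →
      HasCompactSupport g → Continuous fun t => ∫ x, ⟪w (t, x), g x⟫_ℝ)
    (hdiv : ∀ φ : ℝ × (EuclideanSpace ℝ (Fin 2)) → ℝ, ContDiff ℝ ∞ φ → HasCompactSupport φ →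
      ∫ p, ∑ j, w p j * fderiv ℝ φ p (0, EuclideanSpace.single j 1) = 0)
    (t : ℝ) {θ : (EuclideanSpace ℝ (Fin 2)) → ℝ} (hθ : ContDiff ℝ ∞ θ) (hθc : HasCompactSupport θ) :
    ∫ x, ⟪w (t, x), _root_.gradient θ x⟫_ℝ = 0 := by
  -- the gradient of `θ` is a smooth compactly supported field
  have hgθ : ContDiff ℝ ∞ (_root_.gradient θ) := by
    have h : _root_.gradient θ = (InnerProductSpace.toDual ℝ (EuclideanSpace ℝ (Fin 2))).symm ∘
        fderiv ℝ θ := rfl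
    rw [h]
    exact (InnerProductSpace.toDual ℝ (EuclideanSpace ℝ (Fin 2))).symm.contDiff.comp
      (hθ.fderiv_right (m := ∞) (by norm_cast))
  have hgθc : HasCompactSupport (_root_.gradient θ) := by
    have h : _root_.gradient θ = (InnerProductSpace.toDual ℝ (EuclideanSpace ℝ (Fin 2))).symm ∘
        fderiv ℝ θ := rfl
    rw [h]
    exact (hθc.fderiv (𝕜 := ℝ)).comp_left (map_zero _)
  obtain ⟨Mθ, hMθ⟩ := hgθc.exists_bound_of_continuous hgθ.continuous
  have hwC' : ∀ᵐ p : ℝ × (EuclideanSpace ℝ (Fin 2)) ∂volume, ‖w p‖ ≤ C :=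
    ae_norm_le_of_forall_ae_slice hwm hwC
  -- the continuous function `f s = ∫ ṽ(s)·∇θ`
  set f : ℝ → ℝ := fun s => ∫ x, ⟪w (s, x), _root_.gradient θ x⟫_ℝ with hf_def
  have hfc : Continuous f := hcont _ hgθ hgθc
  -- `∫ η f = 0` for every smooth compactly supported `η`
  have hηf : ∀ η : ℝ → ℝ, ContDiff ℝ ∞ η → HasCompactSupport η → ∫ s, η s • f s = 0 := by
    intro η hη hηc
    obtain ⟨A, hA⟩ := hηc.exists_bound_of_continuous hη.continuous
    -- the test function `φ(s, x) = η(s) θ(x)`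
    have hφ : ContDiff ℝ ∞ (fun p : ℝ × (EuclideanSpace ℝ (Fin 2)) => η p.1 * θ p.2) :=
      (hη.comp contDiff_fst).mul (hθ.comp contDiff_snd)
    have hφc : HasCompactSupport (fun p : ℝ × (EuclideanSpace ℝ (Fin 2)) => η p.1 * θ p.2) := by
      refine HasCompactSupport.intro (hηc.isCompact.prod hθc.isCompact) fun p hp => ?_
      rw [mem_prod, not_and_or] at hp
      rcases hp with h | h
      · simp [image_eq_zero_of_notMem_tsupport h]
      · simp [image_eq_zero_of_notMem_tsupport h]
    have hDφ : ∀ (p : ℝ × (EuclideanSpace ℝ (Fin 2))) (v : (EuclideanSpace ℝ (Fin 2))),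
        fderiv ℝ (fun p : ℝ × (EuclideanSpace ℝ (Fin 2)) => η p.1 * θ p.2) p (0, v) =
          η p.1 * fderiv ℝ θ p.2 v := by
      intro p v
      have h1 : HasFDerivAt (fun p : ℝ × (EuclideanSpace ℝ (Fin 2)) => η p.1)
          ((fderiv ℝ η p.1).comp (ContinuousLinearMap.fst ℝ ℝ (EuclideanSpace ℝ (Fin 2)))) p :=
        ((hη.differentiable (by simp)) p.1).hasFDerivAt.comp p hasFDerivAt_fst
      have h2 : HasFDerivAt (fun p : ℝ × (EuclideanSpace ℝ (Fin 2)) => θ p.2)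
          ((fderiv ℝ θ p.2).comp (ContinuousLinearMap.snd ℝ ℝ (EuclideanSpace ℝ (Fin 2)))) p :=
        ((hθ.differentiable (by simp)) p.2).hasFDerivAt.comp p hasFDerivAt_snd
      have h12 : HasFDerivAt (fun p : ℝ × (EuclideanSpace ℝ (Fin 2)) => η p.1 * θ p.2)
          (η p.1 • (fderiv ℝ θ p.2).comp (ContinuousLinearMap.snd ℝ ℝ (EuclideanSpace ℝ (Fin 2))) +
            θ p.2 • (fderiv ℝ η p.1).comp (ContinuousLinearMap.fst ℝ ℝ (EuclideanSpace ℝ (Fin 2)))) p :=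
        h1.mul h2
      rw [h12.fderiv]
      simp
    have hpt : ∀ p : ℝ × (EuclideanSpace ℝ (Fin 2)),
        ∑ j, w p j * fderiv ℝ (fun p : ℝ × (EuclideanSpace ℝ (Fin 2)) => η p.1 * θ p.2) p
          (0, EuclideanSpace.single j 1) = η p.1 * ⟪w p, _root_.gradient θ p.2⟫_ℝ := by
      intro p
      simp_rw [hDφ, inner_gradient_eq_sum_mul_fderiv_single, Finset.mul_sum]
      refine Finset.sum_congr rfl fun j _ => ?_
      ring
    have hId := hdiv _ hφ hφc
    simp_rw [hpt] at hId
    -- the space–time integrand is integrable: bounded, supported in `supp η × supp ∇θ`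
    set F : ℝ × (EuclideanSpace ℝ (Fin 2)) → ℝ := fun p => η p.1 * ⟪w p, _root_.gradient θ p.2⟫_ℝ
      with hF_def
    have hFm : AEStronglyMeasurable F volume :=
      ((hη.continuous.comp continuous_fst).aestronglyMeasurable).mul
        (hwm.inner ((hgθ.continuous.comp continuous_snd).aestronglyMeasurable))
    have hFb : ∀ᵐ p ∂volume, ‖F p‖ ≤ A * (C * Mθ) := by
      filter_upwards [hwC'] with p hp
      rw [hF_def, norm_mul]
      have hC0 : 0 ≤ C := (norm_nonneg _).trans hp
      refine mul_le_mul (hA p.1) ?_ (norm_nonneg _) ((norm_nonneg _).trans (hA p.1))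
      exact (norm_inner_le_norm _ _).trans (mul_le_mul hp (hMθ p.2) (norm_nonneg _) hC0)
    have hFsupp : support F ⊆ tsupport η ×ˢ tsupport (_root_.gradient θ) := by
      intro p hp
      rw [mem_support, hF_def] at hp
      refine ⟨subset_tsupport _ (fun h => hp ?_), subset_tsupport _ (fun h => hp ?_)⟩
      · simp [h]
      · simp [h]
    have hFi : Integrable F volume := by
      rw [← integrableOn_iff_integrable_of_support_subset hFsupp]
      exact Measure.integrableOn_of_bounded (M := A * (C * Mθ))
        (hηc.isCompact.prod hgθc.isCompact).measure_lt_top.ne hFm (ae_restrict_of_ae hFb)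
    -- Fubini
    calc ∫ s, η s • f s = ∫ s, ∫ x, F (s, x) := by
          refine integral_congr_ae (ae_of_all _ fun s => ?_)
          show η s * (∫ x, ⟪w (s, x), _root_.gradient θ x⟫_ℝ) =
            ∫ x, η s * ⟪w (s, x), _root_.gradient θ x⟫_ℝ
          exact (integral_const_mul _ _).symm
      _ = ∫ p, F p := by
          rw [Measure.volume_eq_prod] at hFi ⊢
          exact (integral_prod F hFi).symm
      _ = 0 := hId
  -- `f = 0` a.e., hence everywhere by continuity
  have hae : ∀ᵐ s ∂volume, f s = 0 :=
    ae_eq_zero_of_integral_contDiff_smul_eq_zero hfc.locallyIntegrable hηf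
  have hzero : f = fun _ => 0 := (Continuous.ae_eq_iff_eq volume hfc continuous_const).1 hae
  exact congrFun hzero t

end PlanarCutoff

/-! ### Density of test fields in `L²(ℝ²)` and weak continuity against all of `L²` -/

section PlanarDensity

open scoped Convolution
open ContinuousLinearMap

variable {G : Type*} [NormedAddCommGroup G] [NormedSpace ℝ G] [CompleteSpace G]

/-- **Smoothing a continuous compactly supported function** costs little in `L^p(ℝ²)`: given
`ε`, some mollification `φ ⋆ g` is a smooth compactly supported function with
`‖φ ⋆ g − g‖_{L^p} ≤ ε` (uniform continuity of `g`, `ContDiffBump.dist_normed_convolution_le`).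
[folklore] -/
theorem exists_smooth_eLpNorm_sub_le_of_continuous {p : ℝ≥0∞} (hp0 : p ≠ 0) (hp : p ≠ ⊤)
    {g : (EuclideanSpace ℝ (Fin 2)) → G} (hg : Continuous g) (hgc : HasCompactSupport g) {ε : ℝ≥0∞} (hε : ε ≠ 0) :
    ∃ w : (EuclideanSpace ℝ (Fin 2)) → G, ContDiff ℝ ∞ w ∧ HasCompactSupport w ∧ eLpNorm (w - g) p volume ≤ ε := by
  -- the compact set carrying all the differences, and its (finite) measure
  set K : Set (EuclideanSpace ℝ (Fin 2)) := cthickening 1 (tsupport g) with hK_def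
  have hK : IsCompact K := hgc.isCompact.cthickening
  have hKm : MeasurableSet K := isClosed_cthickening.measurableSet
  have hμK : volume K < ⊤ := hK.measure_lt_top
  set M : ℝ≥0∞ := volume K ^ (1 / p.toReal) with hM_def
  have hM : M ≠ ⊤ := ENNReal.rpow_ne_top_of_nonneg (by positivity) hμK.ne
  -- the admissible uniform error `η`
  set δ : ℝ≥0∞ := min 1 (ε / (M + 1)) with hδ_def
  have hδtop : δ ≠ ⊤ := ne_top_of_le_ne_top ENNReal.one_ne_top (min_le_left _ _)
  have hδ0 : δ ≠ 0 := by
    refine (lt_min zero_lt_one (ENNReal.div_pos hε ?_)).ne'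
    exact ENNReal.add_ne_top.2 ⟨hM, ENNReal.one_ne_top⟩
  have hδM : δ * M ≤ ε := by
    calc δ * M ≤ ε / (M + 1) * (M + 1) := mul_le_mul' (min_le_right _ _) le_self_add
      _ = ε := ENNReal.div_mul_cancel (by simp) (ENNReal.add_ne_top.2 ⟨hM, ENNReal.one_ne_top⟩)
  set η : ℝ := δ.toReal with hη_def
  have hη0 : 0 < η := ENNReal.toReal_pos hδ0 hδtop
  have hηδ : ENNReal.ofReal η = δ := ENNReal.ofReal_toReal hδtop
  -- uniform continuity of `g`
  obtain ⟨ρ, hρ0, hρ⟩ := Metric.uniformContinuous_iff.1 (hgc.uniformContinuous_of_continuous hg) η hη0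
  set r : ℝ := min ρ 1 with hr_def
  have hr0 : 0 < r := lt_min hρ0 one_pos
  let φ : ContDiffBump (0 : (EuclideanSpace ℝ (Fin 2))) := ⟨r / 2, r, half_pos hr0, half_lt_self hr0⟩
  set w : (EuclideanSpace ℝ (Fin 2)) → G := φ.normed volume ⋆[lsmul ℝ ℝ, volume] g with hw_def
  have hgl : LocallyIntegrable g volume := hg.locallyIntegrable
  have hw : ContDiff ℝ ∞ w :=
    φ.hasCompactSupport_normed.contDiff_convolution_left _ φ.contDiff_normed hgl
  have hwc : HasCompactSupport w := φ.hasCompactSupport_normed.convolution _ hgc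
  -- pointwise closeness and support control
  have hclose : ∀ x, dist (w x) (g x) ≤ η := fun x =>
    φ.dist_normed_convolution_le hg.aestronglyMeasurable fun y hy =>
      (hρ ((mem_ball.1 hy).trans_le (min_le_left _ _))).le
  have hsupp : ∀ x, x ∉ K → w x = 0 ∧ g x = 0 := by
    intro x hx
    have hgx : g x = 0 := image_eq_zero_of_notMem_tsupport fun h => hx (self_subset_cthickening _ h)
    refine ⟨?_, hgx⟩
    by_contra hwx
    obtain ⟨a, ha, b, hb, rfl⟩ := support_convolution_subset _ (mem_support.2 hwx)
    have ha' : ‖a‖ < r := by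
      rw [φ.support_normed_eq] at ha
      exact mem_ball_zero_iff.1 ha
    refine hx (mem_cthickening_of_dist_le (a + b) b 1 _ (subset_tsupport _ hb) ?_)
    rw [dist_eq_norm, add_sub_cancel_right]
    exact (ha'.trans_le (min_le_right _ _)).le
  -- the `L^p` bound through the indicator of `K`
  have hbound : ∀ x, ‖(w - g) x‖ ≤ ‖K.indicator (fun _ => η) x‖ := by
    intro x
    by_cases hx : x ∈ K
    · rw [indicator_of_mem hx, Real.norm_of_nonneg hη0.le, Pi.sub_apply, ← dist_eq_norm]
      exact hclose x
    · obtain ⟨h1, h2⟩ := hsupp x hx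
      simp [h1, h2, indicator_of_notMem hx]
  refine ⟨w, hw, hwc, ?_⟩
  calc eLpNorm (w - g) p volume ≤ eLpNorm (K.indicator fun _ => η) p volume := eLpNorm_mono hbound
    _ = ‖η‖ₑ * volume K ^ (1 / p.toReal) := eLpNorm_indicator_const hKm hp0 hp
    _ = δ * M := by rw [Real.enorm_eq_ofReal hη0.le, hηδ]
    _ ≤ ε := hδM

/-- **Smooth compactly supported functions are dense in `L^p(ℝ²)`**, `1 ≤ p < ∞`
(`C_c` is dense — Mathlib's `MemLp.exists_hasCompactSupport_eLpNorm_sub_le` — and `C_c`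
functions are mollified). [folklore] -/
theorem exists_smooth_eLpNorm_sub_le {p : ℝ≥0∞} (hp1 : 1 ≤ p) (hp : p ≠ ⊤) {U : (EuclideanSpace ℝ (Fin 2)) → G}
    (hU : MemLp U p volume) {ε : ℝ≥0∞} (hε : ε ≠ 0) :
    ∃ w : (EuclideanSpace ℝ (Fin 2)) → G, ContDiff ℝ ∞ w ∧ HasCompactSupport w ∧ MemLp w p volume ∧
      eLpNorm (w - U) p volume ≤ ε := by
  have hp0 : p ≠ 0 := (zero_lt_one.trans_le hp1).ne'
  have hε2 : ε / 2 ≠ 0 := (ENNReal.half_pos hε).ne'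
  obtain ⟨g, hgc, hg_le, hg_cont, -⟩ := hU.exists_hasCompactSupport_eLpNorm_sub_le hp hε2
  obtain ⟨w, hw, hwc, hw_le⟩ := exists_smooth_eLpNorm_sub_le_of_continuous hp0 hp hg_cont hgc hε2
  refine ⟨w, hw, hwc, hw.continuous.memLp_of_hasCompactSupport hwc, ?_⟩
  have e : w - U = (w - g) + (g - U) := by abel
  calc eLpNorm (w - U) p volume = eLpNorm ((w - g) + (g - U)) p volume := by rw [e]
    _ ≤ eLpNorm (w - g) p volume + eLpNorm (g - U) p volume :=
        eLpNorm_add_le (hw.continuous.aestronglyMeasurable.sub hg_cont.aestronglyMeasurable)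
          (hg_cont.aestronglyMeasurable.sub hU.1) hp1
    _ ≤ ε / 2 + ε / 2 := add_le_add hw_le (by rwa [eLpNorm_sub_comm])
    _ = ε := ENNReal.add_halves ε

omit [CompleteSpace G] in
/-- Pairings of `L²` fields are integrable. [folklore] -/
private theorem integrable_inner_L2' {α : Type*} [MeasurableSpace α] {μ : Measure α}
    {H : Type*} [NormedAddCommGroup H] [InnerProductSpace ℝ H] {f g : α → H}
    (hf : MemLp f 2 μ) (hg : MemLp g 2 μ) : Integrable (fun x => ⟪f x, g x⟫_ℝ) μ := by
  have hprod : Integrable (fun x => ‖f x‖ * ‖g x‖) μ := hf.norm.integrable_mul hg.norm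
  exact hprod.mono' (hf.1.inner hg.1) (ae_of_all _ fun x => norm_inner_le_norm (f x) (g x))

/-- **Cauchy–Schwarz for the `L²` pairing**:
`|∫ ⟪f, h⟫| ≤ ‖f‖_{L²} ‖h‖_{L²}` (through Mathlib's Hilbert space `L²`). [folklore] -/
theorem abs_integral_inner_le_eLpNorm {α : Type*} [MeasurableSpace α] {μ : Measure α}
    {H : Type*} [NormedAddCommGroup H] [InnerProductSpace ℝ H] [MeasurableSpace H] [BorelSpace H]
    [SecondCountableTopology H]
    {f h : α → H} (hf : MemLp f 2 μ) (hh : MemLp h 2 μ) :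
    |∫ x, ⟪f x, h x⟫_ℝ ∂μ| ≤ (eLpNorm f 2 μ).toReal * (eLpNorm h 2 μ).toReal := by
  have e : ∫ x, ⟪f x, h x⟫_ℝ ∂μ = ⟪hf.toLp f, hh.toLp h⟫_ℝ := by
    rw [L2.inner_def]
    refine integral_congr_ae ?_
    filter_upwards [hf.coeFn_toLp, hh.coeFn_toLp] with x hx hy
    rw [hx, hy]
  rw [e, ← Real.norm_eq_abs]
  refine (norm_inner_le_norm _ _).trans (le_of_eq ?_)
  rw [Lp.norm_toLp, Lp.norm_toLp]

/-- **Weak continuity against all of `L²` from weak continuity against test fields.** If the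
slices `ṽ(t)` are uniformly bounded in `L²(ℝ²)` and `t ↦ ∫ ṽ(t)·g` is continuous for every smooth
compactly supported `g`, then it is continuous for every `g ∈ L²(ℝ²)` (uniform approximation,
`exists_smooth_eLpNorm_sub_le` and Cauchy–Schwarz). [folklore] -/
theorem continuous_integral_inner_of_test {w : ℝ × (EuclideanSpace ℝ (Fin 2)) → (EuclideanSpace ℝ (Fin 2))} {B : ℝ}
    (hw2 : ∀ t, MemLp (fun x => w (t, x)) 2 volume)
    (hwB : ∀ t, (eLpNorm (fun x => w (t, x)) 2 volume).toReal ≤ B)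
    (hcont : ∀ g : (EuclideanSpace ℝ (Fin 2)) → (EuclideanSpace ℝ (Fin 2)), ContDiff ℝ ∞ g → HasCompactSupport g →
      Continuous fun t => ∫ x, ⟪w (t, x), g x⟫_ℝ)
    {g : (EuclideanSpace ℝ (Fin 2)) → (EuclideanSpace ℝ (Fin 2))} (hg : MemLp g 2 volume) : Continuous fun t => ∫ x, ⟪w (t, x), g x⟫_ℝ := by
  -- smooth compactly supported approximants `g_n → g` in `L²`
  have step : ∀ n : ℕ, ∃ gn : (EuclideanSpace ℝ (Fin 2)) → (EuclideanSpace ℝ (Fin 2)), ContDiff ℝ ∞ gn ∧ HasCompactSupport gn ∧ MemLp gn 2 volume ∧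
      eLpNorm (gn - g) 2 volume ≤ ENNReal.ofReal (1 / ((n : ℝ) + 1)) := fun n =>
    exists_smooth_eLpNorm_sub_le one_le_two ENNReal.ofNat_ne_top hg (by positivity)
  choose gn hgn hgnc hgn2 hgnle using step
  have hB0 : 0 ≤ B := le_trans ENNReal.toReal_nonneg (hwB 0)
  -- uniform closeness of the pairings
  have hclose : ∀ n t, dist (∫ x, ⟪w (t, x), g x⟫_ℝ) (∫ x, ⟪w (t, x), gn n x⟫_ℝ) ≤
      B * (1 / ((n : ℝ) + 1)) := by
    intro n t
    rw [Real.dist_eq, ← integral_sub (integrable_inner_L2' (hw2 t) hg) (integrable_inner_L2' (hw2 t) (hgn2 n))]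
    have e : (fun x => ⟪w (t, x), g x⟫_ℝ - ⟪w (t, x), gn n x⟫_ℝ) = fun x => ⟪w (t, x), (g - gn n) x⟫_ℝ := by
      funext x
      rw [Pi.sub_apply, inner_sub_right]
    rw [e]
    refine (abs_integral_inner_le_eLpNorm (hw2 t) (hg.sub (hgn2 n))).trans ?_
    refine mul_le_mul (hwB t) ?_ ENNReal.toReal_nonneg hB0
    rw [← eLpNorm_neg, neg_sub]
    have h := hgnle n
    calc (eLpNorm (gn n - g) 2 volume).toReal ≤ (ENNReal.ofReal (1 / ((n : ℝ) + 1))).toReal :=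
          ENNReal.toReal_mono ENNReal.ofReal_ne_top h
      _ = 1 / ((n : ℝ) + 1) := ENNReal.toReal_ofReal (by positivity)
  -- uniform convergence, hence continuity of the limit
  have hunif : TendstoUniformly (fun n t => ∫ x, ⟪w (t, x), gn n x⟫_ℝ)
      (fun t => ∫ x, ⟪w (t, x), g x⟫_ℝ) atTop := by
    refine Metric.tendstoUniformly_iff.2 fun ε hε => ?_
    have hlim : Tendsto (fun n : ℕ => B * (1 / ((n : ℝ) + 1))) atTop (𝓝 0) := by
      simpa using tendsto_one_div_add_atTop_nhds_zero_nat.const_mul B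
    filter_upwards [(tendsto_order.1 hlim).2 ε hε] with n hn t
    exact (hclose n t).trans_lt hn
  exact hunif.continuous (Eventually.of_forall fun n => hcont (gn n) (hgn n) (hgnc n)).frequently

end PlanarDensity

end Torus

end Literature.Analysis.FluidPDE
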